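import Literature.Topology.FourManifolds.HandleConjugation
import Literature.Topology.FourManifolds.RegularDomainMaps
import Literature.Topology.FourManifolds.RegularSublevelSet
import HarnessLib

/-!
# The handle-extension diffeomorphism of sublevel sets

Topic `Literature/Topology/FourManifolds` (fact seat
`provefact-Literature.Topology.FourManifolds.IsHandlebody.exists_isBoundaryGluing_sphere`, step F2b of
the Lickorish–Wallace DAG; conclusion of the handle-extension step of the classification of
handlebodies: uniqueness of attaching one handle, in the level-compatible form).
Everything here is **proved**; no named facts.

From the data of the handle-extension step on a pair of manifolds with boundary
(`Literature.Topology.FourManifolds.HandlePair`, `HandleConjugation.lean`: two functions `f`,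
`f'` with one critical point each, of the same index, above the cut levels `a`, `a' = a + σ`,
fields with handle charts carrying the same model, their flows, and a lower correspondence
`low` conjugating the flows near the cut levels and matching the feet of the handles) the
handle-extension map `hetMap` is smooth below `ℓ⁺ - δ`, shifts levels by `σ`, and is inverted
by the handle-extension map of the swapped data.  Hence for every level `b` with
`a + η ≤ b ≤ ℓ⁺ - 2δ` (a regular level, the sublevel sets carrying the manifold-with-boundary
structures `sublevelAtlas` of `RegularSublevelSet.lean`):

* `HandlePair.diffeomorphSublevel` — **the sublevel sets `{f ≤ b}` and `{f' ≤ b + σ}` are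
  diffeomorphic**, by a diffeomorphism which is `hetMap` pointwise and therefore satisfies
  `f' (Ψ x) = f x + σ` above the level `a - η/2` (`apply_diffeomorphSublevel`).

This is Milnor's "`W` is diffeomorphic to `ω(V) ∪ H`" (*Lectures on the h-cobordism theorem*
(1965), Thm. 3.13) run simultaneously on two manifolds: the uniqueness of attaching a handle
along matched feet (Kosinski, *Differential Manifolds* (1993), VI (7.2)/(6.6)), with the level
compatibility needed by the induction of the classification of handlebodies.

## References

* J. Milnor, *Lectures on the h-cobordism theorem* (1965), Thm. 3.13 and its proof (PDF
  pp. 18–19). [MilnorHCobordism1965]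
* A. Kosinski, *Differential Manifolds* (1993), VI §§6–7. [Kosinski1993]
* J. M. Lee, *Introduction to Smooth Manifolds*, 2nd ed. (2013), Cor. 5.30. [LeeSmoothManifolds2013]
-/

open scoped Manifold ContDiff Topology
open Set Function Filter Metric

noncomputable section

namespace Literature.Topology.FourManifolds

universe u

namespace HandlePair

variable {n : ℕ} {M : Type u} [TopologicalSpace M] [T2Space M] [ChartedSpace (EuclideanHalfSpace (n + 1)) M]
  [IsManifold (𝓡∂ (n + 1)) ∞ M]
  {M' : Type u} [TopologicalSpace M'] [T2Space M'] [ChartedSpace (EuclideanHalfSpace (n + 1)) M']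
  [IsManifold (𝓡∂ (n + 1)) ∞ M']
  (P : HandlePair (𝓡∂ (n + 1)) M M')

omit [T2Space M] [T2Space M'] in
/-- Swapping twice gives back the pair. [folklore] -/
@[simp] theorem swap_swap : P.swap.swap = P := rfl

omit [T2Space M] [T2Space M'] in
/-- The handle-extension map of the twice swapped pair. [folklore] -/
theorem swap_swap_hetMap : P.swap.swap.hetMap = P.hetMap := rfl

omit [T2Space M] [T2Space M'] in
/-- `hetMap` maps `{f ≤ b}` into `{f' ≤ b + σ}` for `a ≤ b ≤ ℓ⁺`. [folklore] -/
theorem hetMap_mem {b : ℝ} (hab : P.S.a ≤ b) (hb : b ≤ P.S.ℓu) (x : ↥(P.S.f ⁻¹' Iic b)) :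
    P.hetMap x.1 ∈ P.S'.f ⁻¹' Iic (b + P.σ) :=
  P.apply_hetMap_le hab hb x.2

omit [T2Space M] [T2Space M'] in
/-- `hetMap` of the swapped pair maps `{f' ≤ b + σ}` into `{f ≤ b}` for `a ≤ b ≤ ℓ⁺`. [folklore] -/
theorem swap_hetMap_mem {b : ℝ} (hab : P.S.a ≤ b) (hb : b ≤ P.S.ℓu) (y : ↥(P.S'.f ⁻¹' Iic (b + P.σ))) :
    P.swap.hetMap y.1 ∈ P.S.f ⁻¹' Iic b := by
  have h := P.swap.apply_hetMap_le (b := b + P.σ) (by show P.S'.a ≤ b + P.σ; rw [P.ha]; unfold σ; linarith)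
    (by show b + P.σ ≤ P.S'.ℓu; rw [P.hℓu]; unfold σ; linarith) y.2
  rw [swap_σ] at h
  show P.S.f (P.swap.hetMap y.1) ≤ b
  have : P.swap.S'.f (P.swap.hetMap y.1) = P.S.f (P.swap.hetMap y.1) := rfl
  linarith [h]

variable (hn : 1 ≤ n) {b : ℝ} (hb₁ : P.S.a + P.S.η ≤ b) (hb₂ : b ≤ P.S.ℓu - 2 * P.S.δ)
  (hint : ∀ x, P.S.f x ≤ b → (𝓡∂ (n + 1)).IsInteriorPoint x)
  (hreg : ∀ x, P.S.f x = b → ¬ IsMCriticalPt (𝓡∂ (n + 1)) P.S.f x)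
  (hint' : ∀ x, P.S'.f x ≤ b + P.σ → (𝓡∂ (n + 1)).IsInteriorPoint x)
  (hreg' : ∀ x, P.S'.f x = b + P.σ → ¬ IsMCriticalPt (𝓡∂ (n + 1)) P.S'.f x)

include hn hb₁ hb₂ in
/-- **The handle-extension diffeomorphism of the sublevel sets** `{f ≤ b} ≅ {f' ≤ b + σ}`
(`a + η ≤ b ≤ ℓ⁺ - 2δ`; structures `sublevelAtlas`): `hetMap` restricted and corestricted, with
inverse the restriction of the handle-extension map of the swapped data
(`HandlePair.swap_hetMap_hetMap`), both smooth into the regular domains by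
`HalfSliceAtlas.contMDiffAt_codRestrict` (Lee 2013, Cor. 5.30).  Milnor 1965, Thm. 3.13;
Kosinski 1993, VI (7.2). [cite: MilnorHCobordism1965, Thm. 3.13 and its proof (PDF pp. 18–19)] -/
def diffeomorphSublevel :
    letI := (sublevelAtlas P.S.hf b hint hreg).chartedSpace
    letI := (sublevelAtlas P.S'.hf (b + P.σ) hint' hreg').chartedSpace
    ↥(P.S.f ⁻¹' Iic b) ≃ₘ⟮𝓡∂ (n + 1), 𝓡∂ (n + 1)⟯ ↥(P.S'.f ⁻¹' Iic (b + P.σ)) := by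
  letI csM := (sublevelAtlas P.S.hf b hint hreg).chartedSpace
  letI csM' := (sublevelAtlas P.S'.hf (b + P.σ) hint' hreg').chartedSpace
  haveI := (sublevelAtlas P.S.hf b hint hreg).isManifold
  haveI := (sublevelAtlas P.S'.hf (b + P.σ) hint' hreg').isManifold
  have hab : P.S.a ≤ b := by linarith [P.S.η_pos]
  have hbu : b ≤ P.S.ℓu := by linarith [P.S.δ_pos]
  have hab' : P.S'.a ≤ b + P.σ := by rw [P.ha]; unfold σ; linarith
  have hbu' : b + P.σ ≤ P.S'.ℓu := by rw [P.hℓu]; unfold σ; linarith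
  -- smoothness of the two maps
  have hto : ContMDiff (𝓡∂ (n + 1)) (𝓡∂ (n + 1)) ∞
      ((P.S'.f ⁻¹' Iic (b + P.σ)).codRestrict (fun x : ↥(P.S.f ⁻¹' Iic b) => P.hetMap x.1) (P.hetMap_mem hab hbu)) := by
    intro x
    refine (sublevelAtlas P.S'.hf (b + P.σ) hint' hreg').contMDiffAt_codRestrict (P.hetMap_mem hab hbu) ?_
    have h1 : ContMDiffAt (𝓡∂ (n + 1)) (𝓡∂ (n + 1)) ∞ P.hetMap x.1 :=
      P.contMDiffOn_hetMap.contMDiffAt ((isOpen_lt P.S.hf.continuous continuous_const).mem_nhds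
        (by show P.S.f x.1 < P.S.ℓu - P.S.δ; linarith [x.2, P.S.δ_pos, show P.S.f x.1 ≤ b from x.2]))
    exact h1.comp x (((sublevelAtlas P.S.hf b hint hreg).contMDiff_subtype_val hn) x)
  have hinv : ContMDiff (𝓡∂ (n + 1)) (𝓡∂ (n + 1)) ∞
      ((P.S.f ⁻¹' Iic b).codRestrict (fun y : ↥(P.S'.f ⁻¹' Iic (b + P.σ)) => P.swap.hetMap y.1) (P.swap_hetMap_mem hab hbu)) := by
    intro y
    refine (sublevelAtlas P.S.hf b hint hreg).contMDiffAt_codRestrict (P.swap_hetMap_mem hab hbu) ?_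
    have h1 : ContMDiffAt (𝓡∂ (n + 1)) (𝓡∂ (n + 1)) ∞ P.swap.hetMap y.1 :=
      P.swap.contMDiffOn_hetMap.contMDiffAt ((isOpen_lt P.S'.hf.continuous continuous_const).mem_nhds
        (by
          show P.S'.f y.1 < P.S'.ℓu - P.S'.δ
          have hy : P.S'.f y.1 ≤ b + P.σ := y.2
          rw [P.hℓu, P.hδ]; unfold σ at hy; linarith [P.S.δ_pos]))
    exact h1.comp y (((sublevelAtlas P.S'.hf (b + P.σ) hint' hreg').contMDiff_subtype_val hn) y)
  exact
    { toFun := (P.S'.f ⁻¹' Iic (b + P.σ)).codRestrict (fun x : ↥(P.S.f ⁻¹' Iic b) => P.hetMap x.1) (P.hetMap_mem hab hbu)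
      invFun := (P.S.f ⁻¹' Iic b).codRestrict (fun y : ↥(P.S'.f ⁻¹' Iic (b + P.σ)) => P.swap.hetMap y.1) (P.swap_hetMap_mem hab hbu)
      left_inv := fun x => Subtype.ext (P.swap_hetMap_hetMap (x.2.trans hbu))
      right_inv := fun y => Subtype.ext (by
        show P.hetMap (P.swap.hetMap y.1) = y.1
        have h := P.swap.swap_hetMap_hetMap (x := y.1) (y.2.trans hbu')
        rw [swap_swap_hetMap] at h
        exact h)
      contMDiff_toFun := hto
      contMDiff_invFun := hinv }

include hn hb₁ hb₂ in
/-- The handle-extension diffeomorphism is `hetMap` pointwise. [folklore] -/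
theorem diffeomorphSublevel_apply (x : ↥(P.S.f ⁻¹' Iic b)) :
    letI := (sublevelAtlas P.S.hf b hint hreg).chartedSpace
    letI := (sublevelAtlas P.S'.hf (b + P.σ) hint' hreg').chartedSpace
    (P.diffeomorphSublevel hn hb₁ hb₂ hint hreg hint' hreg' x).1 = P.hetMap x.1 := rfl

include hn hb₁ hb₂ in
/-- **Level compatibility of the handle-extension diffeomorphism**: `f' (Ψ x) = f x + σ` for
`a - η/2 < f x`. [cite: MilnorHCobordism1965, proof of Thm. 3.13 (PDF pp. 18–19)] -/
theorem apply_diffeomorphSublevel (x : ↥(P.S.f ⁻¹' Iic b)) (hx : P.S.a - P.S.η / 2 < P.S.f x.1) :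
    letI := (sublevelAtlas P.S.hf b hint hreg).chartedSpace
    letI := (sublevelAtlas P.S'.hf (b + P.σ) hint' hreg').chartedSpace
    P.S'.f (P.diffeomorphSublevel hn hb₁ hb₂ hint hreg hint' hreg' x).1 = P.S.f x.1 + P.σ :=
  P.apply_hetMap hx (x.2.trans (by linarith [P.S.δ_pos]))

end HandlePair

end Literature.Topology.FourManifolds
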